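import Literature.AlgebraicGeometry.Motives.HodgeLieDerivedSemisimple
import HarnessLib

/-!
# `Lie Hg(H) = 𝔷 ⊕ [Lie Hg, Lie Hg]` with `[Lie Hg, Lie Hg]` semisimple for a polarizable Hodge structure of ANY weight (Deligne LNM 900 I Prop. 3.6, Lie form; Zarhin 1983 §2 for K3 type)

Family `hodge`, layer `Literature/AlgebraicGeometry/Motives` (abstract polarizable `ℚ`-Hodge structures; no geometry). Cell
`pub-hodgecm2` (COR-CM), seat `b27` (count-neutral own lane MT-REDUCTIVE); UNCONDITIONAL, theorems only (no definition, no named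
fact, D-0026); no step towards a summit statement.

The weight-one files of this lane (`HodgeThetaSubalgebraReductive`, `HodgeLieDerivedSemisimple`, `HodgeLieCentralRadical`) take the
non-degeneracy of the trace form from `HodgeThetaSubalgebraPerfect`, whose proof uses `Θ² = 1` (effective weight one). For
`𝔤 = Lie Hg(H)` itself that restriction is unnecessary: the Hodge-form adjoint of `X_ℂ` (`X ∈ Lie Hg`, rational, `ψ`-skew) is
`X^* = -C X_ℂ C⁻¹` for the Weil operator `C` in EVERY weight (the tree's `form_weil_conj_baseChange_apply`,
`conj_mem_hodgeLieC_of_forall_piece`), and `tr(X_ℂ X^*) = Σ |X_{στ}|² > 0` in an `h`-orthonormal graded basis. This file records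
the any-weight versions — relevant e.g. for Hodge structures of K3 type (weight `2`; Zarhin, *Hodge groups of K3 surfaces*, §2:
`Hg` is reductive, indeed semisimple or a torus extension according to `E = End_Hdg`).

RESULTS (`H` a `ℚ`-Hodge structure of weight `n` on a finite-dimensional `V`, `ψ` a polarization, `𝔥 = hodgeLie H`,
`𝔷 = 𝔥 ⊓ End_Hdg(V)`, `𝔡 = span {XY - YX : X, Y ∈ 𝔥}`; namespace `HodgeStructure.AnyWeight`):
* `eq_zero_of_forall_trace_mul_eq_zero` — the trace form `tr(XY)` of `V` is non-degenerate on any rational `ψ`-skew `𝔤` whose complex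
  span is `Ad(C)`-stable (no weight hypothesis); **`hodgeLie_trace_separating`** — the case `𝔤 = Lie Hg`.
* **`hodgeLie_center_sup_derived_eq`**, `finrank_hodgeLie_eq_center_add_derived`, `hodgeLie_derived_perfect`,
  `hodgeLie_derived_center_trivial`, `hodgeLie_derived_trace_separating`, `hodgeLie_derived_eq_bot_iff_le_endAlg` — `𝔥 = 𝔷 ⊕ 𝔡`
  etc. in every weight (the linear algebra `Literature.Algebra.Lie.TraceSeparating` with the tree's any-weight inputs
  `hodgeLie_center_eq_inf_endAlg`, `hodgeLie_center_inf_derived_eq_bot`).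
* **`hodgeLie_derived_abelian_ideal_eq_bot`**, **`hasTrivialRadical_of_eq_hodgeLie_derived`**, **`isSemisimple_of_eq_hodgeLie_derived`**,
  `isKilling_of_eq_hodgeLie_derived` — `𝔡` is semisimple in every weight (abelian ideals of `𝔥` are central,
  `le_inf_endAlg_of_abelian_ideal`, any weight).

## References
* [Deligne1982HodgeCycles] P. Deligne, LNM 900 (1982), I Prop. 3.6.
* [Zarhin1983HodgeGroupsK3] Yu. G. Zarhin, J. reine angew. Math. 341 (1983), §2.
* [Humphreys1972] J. E. Humphreys, GTM 9, §19.1.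
-/

noncomputable section

open scoped TensorProduct
open Complex

namespace Literature.AlgebraicGeometry.Motives

namespace HodgeStructure

namespace AnyWeight

universe u

variable {V : Type u} [AddCommGroup V] [Module ℚ V] [Module.Finite ℚ V] [HodgeTensorFacts.{u, u}] {n : ℤ}

/-! ### §1 The trace form is non-degenerate on `Ad(C)`-stable rational skew Lie algebras, in every weight -/

omit [HodgeTensorFacts.{u, u}] in
/-- A rational operator with vanishing complexification vanishes (descent `mem_of_baseChange_mem_spanC` for `⊥`). Private
plumbing. [folklore] -/
private theorem eq_zero_of_baseChange_eq_zero'' {X : Module.End ℚ V} (hX : X.baseChange ℂ = 0) : X = 0 := by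
  have h : X ∈ (⊥ : Submodule ℚ (Module.End ℚ V)) :=
    mem_of_baseChange_mem_spanC ⊥ (by rw [hX]; exact Submodule.zero_mem _)
  exact (Submodule.mem_bot ℚ).1 h

/-- **The trace form `tr(XY)` of `V` is non-degenerate on every rational `𝔤 ⊆ 𝔰𝔭(V, ψ)` whose complex span is stable under
`Ad(C)` for the Weil operator `C`** — ANY weight. PROOF (Deligne I 3.6; Green–Griffiths–Kerr (I.B.6)): the `h`-adjoint of `X_ℂ`
(`X ∈ 𝔤`) for the Hodge form `h(x, y) = ψ_ℂ(C x, ȳ)` is `X^* = -C X_ℂ C⁻¹ ∈ 𝔤_ℂ` (`form_weil_conj_baseChange_apply`); in an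
`h`-orthonormal graded basis its matrix is the conjugate transpose of that of `X_ℂ`, so `tr(X_ℂ X^*) = Σ |X_{στ}|²`, while
`Y ↦ tr(X_ℂ Y)` kills `𝔤_ℂ` if `tr(XY) = 0` for all `Y ∈ 𝔤`. [cite: Deligne1982HodgeCycles, I §3 Prop. 3.6]
[cite: GreenGriffithsKerr2012, (I.B.6)] -/
theorem eq_zero_of_forall_trace_mul_eq_zero (H : HodgeStructure V n) (ψ : H.Polarization)
    (𝔤 : Submodule ℚ (Module.End ℚ V))
    (hC𝔤 : ∀ C : (ℂ ⊗[ℚ] V) ≃ₗ[ℂ] (ℂ ⊗[ℚ] V), (∀ p, ∀ x ∈ H.piece p (n - p), C x = (Complex.I ^ (2 * p - n)) • x) →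
      ∀ Y ∈ spanC 𝔤, (C : ℂ ⊗[ℚ] V →ₗ[ℂ] ℂ ⊗[ℚ] V) ∘ₗ Y ∘ₗ (C.symm : ℂ ⊗[ℚ] V →ₗ[ℂ] ℂ ⊗[ℚ] V) ∈ spanC 𝔤)
    (hskew : ∀ X ∈ 𝔤, ∀ v w, ψ.form (X v) w + ψ.form v (X w) = 0)
    {X : Module.End ℚ V} (hX : X ∈ 𝔤) (htr : ∀ Y ∈ 𝔤, LinearMap.trace ℚ V (X * Y) = 0) : X = 0 := by
  classical
  obtain ⟨C, hC, -⟩ := exists_weilOperator H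
  obtain ⟨S, _, _, deg, e, hF, hFc, -, horth⟩ := ψ.exists_orthonormal_graded_basis
  have hsum := form_weil_conj_eq_sum ψ e hF hFc horth hC
  set Xc : Module.End ℂ (ℂ ⊗[ℚ] V) := X.baseChange ℂ with hXc
  -- the `h`-adjoint `X^* = -C X_ℂ C⁻¹`
  set Xs : Module.End ℂ (ℂ ⊗[ℚ] V) :=
    -((C : ℂ ⊗[ℚ] V →ₗ[ℂ] ℂ ⊗[ℚ] V) ∘ₗ Xc ∘ₗ (C.symm : ℂ ⊗[ℚ] V →ₗ[ℂ] ℂ ⊗[ℚ] V)) with hXs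
  have hXs𝔤 : Xs ∈ spanC 𝔤 := Submodule.neg_mem _ (hC𝔤 C hC _ (baseChange_mem_spanC hX))
  have hskewC : ∀ u v : ℂ ⊗[ℚ] V, ψ.form.baseChange ℂ (Xc u) v = -ψ.form.baseChange ℂ u (Xc v) :=
    fun u v => eq_neg_of_add_eq_zero_left (ThetaSubalgebra.formBaseChange_add_eq_zero_of_skew ψ (hskew X hX) u v)
  have hadj : ∀ x y : ℂ ⊗[ℚ] V,
      ψ.form.baseChange ℂ (C (Xc x)) (conj y) = ψ.form.baseChange ℂ (C x) (conj (Xs y)) := by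
    intro x y
    rw [form_weil_conj_baseChange_apply ψ hC hskewC x y]
    rfl
  -- matrices in the orthonormal basis: `M' τ σ = conj (M σ τ)`
  set M : Matrix S S ℂ := LinearMap.toMatrix e e Xc with hM
  set M' : Matrix S S ℂ := LinearMap.toMatrix e e Xs with hM'
  have hMM' : ∀ σ τ, M σ τ = starRingEnd ℂ (M' τ σ) := by
    intro σ τ
    have h := hadj (e τ) (e σ)
    rw [hsum, hsum] at h
    rw [Finset.sum_eq_single σ, Finset.sum_eq_single τ] at h
    · simpa [hM, hM', LinearMap.toMatrix_apply, Module.Basis.repr_self, Finsupp.single_apply] using h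
    · intro ρ _ hρ
      rw [Module.Basis.repr_self, Finsupp.single_apply, if_neg (Ne.symm hρ), zero_mul]
    · intro h; exact absurd (Finset.mem_univ τ) h
    · intro ρ _ hρ
      rw [Module.Basis.repr_self, Finsupp.single_apply, if_neg (Ne.symm hρ), map_zero, mul_zero]
    · intro h; exact absurd (Finset.mem_univ σ) h
  have hM'M : ∀ σ τ, M' τ σ = starRingEnd ℂ (M σ τ) := fun σ τ => by
    rw [hMM' σ τ, starRingEnd_self_apply]
  -- `tr(X_ℂ X^*) = Σ |M σ τ|²`
  have htrace : LinearMap.trace ℂ _ (Xc * Xs) = ∑ σ, ∑ τ, ((Complex.normSq (M σ τ) : ℝ) : ℂ) := by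
    rw [LinearMap.trace_eq_matrix_trace ℂ e, LinearMap.toMatrix_mul, Matrix.trace]
    refine Finset.sum_congr rfl fun σ _ => ?_
    rw [Matrix.diag_apply, Matrix.mul_apply]
    refine Finset.sum_congr rfl fun τ _ => ?_
    change M σ τ * M' τ σ = _
    rw [hM'M σ τ, Complex.mul_conj]
  -- the functional `Y ↦ tr(X_ℂ Y)` kills `𝔤_ℂ`
  have hkill : ∀ Y ∈ spanC 𝔤, LinearMap.trace ℂ _ (Xc * Y) = 0 := by
    intro Y hY
    induction hY using Submodule.span_induction with
    | mem Z hZ =>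
      obtain ⟨Y, hY, rfl⟩ := hZ
      rw [hXc, ← LinearMap.baseChange_mul, LinearMap.trace_baseChange, htr Y hY, map_zero]
    | zero => rw [mul_zero, map_zero]
    | add Z Z' _ _ hZ hZ' => rw [mul_add, map_add, hZ, hZ', add_zero]
    | smul c Z _ hZ => rw [mul_smul_comm, map_smul, hZ, smul_zero]
  have hzero : ∑ σ, ∑ τ, ((Complex.normSq (M σ τ) : ℝ) : ℂ) = 0 := by rw [← htrace]; exact hkill Xs hXs𝔤
  have hreal : (∑ σ, ∑ τ, Complex.normSq (M σ τ)) = 0 := by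
    have h : ((∑ σ, ∑ τ, Complex.normSq (M σ τ) : ℝ) : ℂ) = 0 := by push_cast; exact hzero
    exact_mod_cast h
  have hMzero : ∀ σ τ, M σ τ = 0 := by
    intro σ τ
    have h1 : ∑ τ', Complex.normSq (M σ τ') = 0 :=
      (Finset.sum_eq_zero_iff_of_nonneg (fun σ' _ =>
        Finset.sum_nonneg fun τ' _ => Complex.normSq_nonneg (M σ' τ'))).1 hreal σ (Finset.mem_univ σ)
    have h2 := (Finset.sum_eq_zero_iff_of_nonneg (fun τ' _ => Complex.normSq_nonneg (M σ τ'))).1 h1 τ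
      (Finset.mem_univ τ)
    exact Complex.normSq_eq_zero.1 h2
  have hXc0 : Xc = 0 := by
    have hM0 : M = 0 := Matrix.ext fun σ τ => by rw [hMzero, Matrix.zero_apply]
    have h : LinearMap.toMatrix e e Xc = LinearMap.toMatrix e e 0 := by rw [← hM, hM0, map_zero]
    exact (LinearMap.toMatrix e e).injective h
  exact eq_zero_of_baseChange_eq_zero'' hXc0

/-- **The trace form of `V` is non-degenerate on `Lie Hg(H)`, for a polarizable `H` of ANY weight** (`(Lie Hg)_ℂ` is
`Ad(C)`-stable, `conj_mem_hodgeLieC_of_forall_piece`; `Lie Hg ⊆ 𝔰𝔭(V, ψ)`, `form_apply_add_eq_zero_of_mem_hodgeLie`).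
[cite: Deligne1982HodgeCycles, I §3 Prop. 3.6] [cite: Zarhin1983HodgeGroupsK3, §2] -/
theorem hodgeLie_trace_separating (H : HodgeStructure V n) (ψ : H.Polarization) {X : Module.End ℚ V}
    (hX : X ∈ H.hodgeLie) (htr : ∀ Y ∈ H.hodgeLie, LinearMap.trace ℚ V (X * Y) = 0) : X = 0 :=
  eq_zero_of_forall_trace_mul_eq_zero H ψ H.hodgeLie
    (fun _ hC _ hY => by rw [← hodgeLieC_eq_spanC] at hY ⊢; exact H.conj_mem_hodgeLieC_of_forall_piece hC hY)
    (fun _ hX v w => form_apply_add_eq_zero_of_mem_hodgeLie ψ hX v w) hX htr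

/-! ### §2 `Lie Hg = 𝔷 ⊕ 𝔡` in every weight -/

/-- The anisotropy input: a central `Z ∈ Lie Hg` with `tr(Z²) = 0` vanishes (any weight, from `HodgeThetaSubalgebraReductive`).
[cite: Deligne1982HodgeCycles, I §3 Prop. 3.6] -/
theorem hodgeLie_center_anisotropic (H : HodgeStructure V n) (ψ : H.Polarization) :
    ∀ Z ∈ H.hodgeLie, (∀ Y ∈ H.hodgeLie, Z * Y = Y * Z) → LinearMap.trace ℚ V (Z * Z) = 0 → Z = 0 := by
  obtain ⟨-, hskew, -, Θ, hΘ, hΘ𝔤⟩ := hodgeLie_standing H ψ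
  exact fun Z hZ hZc htr => eq_zero_of_central_of_trace_mul_self_eq_zero H ψ H.hodgeLie hΘ hΘ𝔤 hskew hZ hZc htr

/-- **`Lie Hg(H) = (Lie Hg ∩ End_Hdg(V)) ⊕ [Lie Hg, Lie Hg]` for a polarizable Hodge structure of ANY weight** (sum part; the
intersection is `0` by the tree's `hodgeLie_center_inf_derived_eq_bot`). [cite: Deligne1982HodgeCycles, I §3 Prop. 3.6]
[cite: Zarhin1983HodgeGroupsK3, §2] [cite: Humphreys1972, §19.1] -/
theorem hodgeLie_center_sup_derived_eq (H : HodgeStructure V n) (ψ : H.Polarization) :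
    H.hodgeLie ⊓ Subalgebra.toSubmodule H.endAlg ⊔
      Submodule.span ℚ {B | ∃ X ∈ H.hodgeLie, ∃ Y ∈ H.hodgeLie, X * Y - Y * X = B} = H.hodgeLie := by
  obtain ⟨hbr, -, -, -⟩ := hodgeLie_standing H ψ
  rw [← hodgeLie_center_eq_inf_endAlg]
  exact Literature.Algebra.Lie.TraceSeparating.center_sup_derived_eq H.hodgeLie hbr
    (fun _ hX htr => hodgeLie_trace_separating H ψ hX htr) (hodgeLie_center_anisotropic H ψ)

/-- **`dim Lie Hg = dim (Lie Hg ∩ End_Hdg) + dim [Lie Hg, Lie Hg]`**, any weight. [cite: Deligne1982HodgeCycles, I §3 Prop. 3.6]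
[cite: Humphreys1972, §19.1] -/
theorem finrank_hodgeLie_eq_center_add_derived (H : HodgeStructure V n) (ψ : H.Polarization) :
    Module.finrank ℚ H.hodgeLie =
      Module.finrank ℚ ↥(H.hodgeLie ⊓ Subalgebra.toSubmodule H.endAlg) +
        Module.finrank ℚ ↥(Submodule.span ℚ {B | ∃ X ∈ H.hodgeLie, ∃ Y ∈ H.hodgeLie, X * Y - Y * X = B}) := by
  obtain ⟨hbr, -, -, -⟩ := hodgeLie_standing H ψ
  rw [← hodgeLie_center_eq_inf_endAlg]
  exact (Literature.Algebra.Lie.TraceSeparating.finrank_center_add_finrank_derived H.hodgeLie hbr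
    fun _ hX htr => hodgeLie_trace_separating H ψ hX htr).symm

/-- **`[Lie Hg, Lie Hg]` is perfect**, any weight. [cite: Humphreys1972, §19.1] [cite: Deligne1982HodgeCycles, I §3 Prop. 3.6] -/
theorem hodgeLie_derived_perfect (H : HodgeStructure V n) (ψ : H.Polarization) :
    Submodule.span ℚ {B | ∃ X ∈ H.hodgeLie, ∃ Y ∈ H.hodgeLie, X * Y - Y * X = B} =
      Submodule.span ℚ {B | ∃ X ∈ Submodule.span ℚ {B | ∃ X ∈ H.hodgeLie, ∃ Y ∈ H.hodgeLie, X * Y - Y * X = B},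
        ∃ Y ∈ Submodule.span ℚ {B | ∃ X ∈ H.hodgeLie, ∃ Y ∈ H.hodgeLie, X * Y - Y * X = B},
          X * Y - Y * X = B} := by
  obtain ⟨hbr, -, -, -⟩ := hodgeLie_standing H ψ
  exact Literature.Algebra.Lie.TraceSeparating.derived_eq_span_commutators_derived H.hodgeLie hbr
    (fun _ hX htr => hodgeLie_trace_separating H ψ hX htr) (hodgeLie_center_anisotropic H ψ)

/-- **`[Lie Hg, Lie Hg]` is centre-free**, any weight. [cite: Humphreys1972, §19.1] [cite: Deligne1982HodgeCycles, I §3 Prop. 3.6] -/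
theorem hodgeLie_derived_center_trivial (H : HodgeStructure V n) (ψ : H.Polarization) {C : Module.End ℚ V}
    (hC : C ∈ Submodule.span ℚ {B | ∃ X ∈ H.hodgeLie, ∃ Y ∈ H.hodgeLie, X * Y - Y * X = B})
    (hCc : ∀ D ∈ Submodule.span ℚ {B | ∃ X ∈ H.hodgeLie, ∃ Y ∈ H.hodgeLie, X * Y - Y * X = B}, C * D = D * C) :
    C = 0 := by
  obtain ⟨hbr, -, -, -⟩ := hodgeLie_standing H ψ
  exact Literature.Algebra.Lie.TraceSeparating.eq_zero_of_mem_derived_of_forall_commute H.hodgeLie hbr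
    (fun _ hX htr => hodgeLie_trace_separating H ψ hX htr) (hodgeLie_center_anisotropic H ψ) hC hCc

/-- **The trace form is non-degenerate on `[Lie Hg, Lie Hg]`**, any weight. [cite: Humphreys1972, §5.1]
[cite: Deligne1982HodgeCycles, I §3 Prop. 3.6] -/
theorem hodgeLie_derived_trace_separating (H : HodgeStructure V n) (ψ : H.Polarization) {D : Module.End ℚ V}
    (hD : D ∈ Submodule.span ℚ {B | ∃ X ∈ H.hodgeLie, ∃ Y ∈ H.hodgeLie, X * Y - Y * X = B})
    (htr : ∀ D' ∈ Submodule.span ℚ {B | ∃ X ∈ H.hodgeLie, ∃ Y ∈ H.hodgeLie, X * Y - Y * X = B},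
      LinearMap.trace ℚ V (D * D') = 0) : D = 0 := by
  obtain ⟨hbr, -, -, -⟩ := hodgeLie_standing H ψ
  exact Literature.Algebra.Lie.TraceSeparating.eq_zero_of_mem_derived_of_forall_trace_mul_eq_zero H.hodgeLie hbr
    (fun _ hX htr => hodgeLie_trace_separating H ψ hX htr) (hodgeLie_center_anisotropic H ψ) hD htr

/-- **`[Lie Hg, Lie Hg] = 0` iff `Lie Hg ⊆ End_Hdg(V)`** (iff `Lie Hg` is abelian), any weight. [cite: Deligne1982HodgeCycles, I §3 Prop. 3.6]
[cite: Zarhin1983HodgeGroupsK3, §2] -/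
theorem hodgeLie_derived_eq_bot_iff_le_endAlg (H : HodgeStructure V n) (ψ : H.Polarization) :
    Submodule.span ℚ {B | ∃ X ∈ H.hodgeLie, ∃ Y ∈ H.hodgeLie, X * Y - Y * X = B} = ⊥ ↔
      H.hodgeLie ≤ Subalgebra.toSubmodule H.endAlg := by
  constructor
  · intro h
    have hsup := hodgeLie_center_sup_derived_eq H ψ
    rw [h, sup_bot_eq] at hsup
    rw [← hsup]
    exact inf_le_right
  · intro h
    rw [Submodule.eq_bot_iff]
    intro B hB
    induction hB using Submodule.span_induction with
    | mem B hB =>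
      obtain ⟨X, hX, Y, hY, rfl⟩ := hB
      have hc : X * Y = Y * X := H.commute_of_mem_hodgeLie hX ⟨Y, h hY⟩
      rw [hc, sub_self]
    | zero => rfl
    | add B B' _ _ hB hB' => rw [hB, hB', add_zero]
    | smul c B _ hB => rw [hB, smul_zero]

/-! ### §3 `[Lie Hg, Lie Hg]` is semisimple, in every weight -/

/-- **`𝔡 = [Lie Hg, Lie Hg]` has no non-zero abelian ideal**, any weight (abelian ideals of `𝔥 = 𝔷 ⊕ 𝔡` are central,
`le_inf_endAlg_of_abelian_ideal`, and `𝔷 ∩ 𝔡 = 0`). [cite: Deligne1982HodgeCycles, I §3 Prop. 3.6] [cite: Humphreys1972, §19.1] -/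
theorem hodgeLie_derived_abelian_ideal_eq_bot (H : HodgeStructure V n) (ψ : H.Polarization)
    {𝔞 : Submodule ℚ (Module.End ℚ V)}
    (h𝔞 : 𝔞 ≤ Submodule.span ℚ {B | ∃ X ∈ H.hodgeLie, ∃ Y ∈ H.hodgeLie, X * Y - Y * X = B})
    (hideal : ∀ D ∈ Submodule.span ℚ {B | ∃ X ∈ H.hodgeLie, ∃ Y ∈ H.hodgeLie, X * Y - Y * X = B},
      ∀ A ∈ 𝔞, D * A - A * D ∈ 𝔞)
    (hab : ∀ A ∈ 𝔞, ∀ B ∈ 𝔞, A * B = B * A) : 𝔞 = ⊥ := by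
  obtain ⟨hbr, -, -, -⟩ := hodgeLie_standing H ψ
  have h𝔡le : Submodule.span ℚ {B | ∃ X ∈ H.hodgeLie, ∃ Y ∈ H.hodgeLie, X * Y - Y * X = B} ≤ H.hodgeLie :=
    Literature.Algebra.Lie.TraceSeparating.derived_le H.hodgeLie hbr
  have hideal' : ∀ X ∈ H.hodgeLie, ∀ A ∈ 𝔞, X * A - A * X ∈ 𝔞 := by
    intro X hX A hA
    have hX' : X ∈ H.hodgeLie ⊓ Subalgebra.toSubmodule H.endAlg ⊔
        Submodule.span ℚ {B | ∃ X ∈ H.hodgeLie, ∃ Y ∈ H.hodgeLie, X * Y - Y * X = B} := by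
      rw [hodgeLie_center_sup_derived_eq H ψ]; exact hX
    obtain ⟨Z, hZ, D, hD, rfl⟩ := Submodule.mem_sup.1 hX'
    rw [← hodgeLie_center_eq_inf_endAlg, Literature.Algebra.Lie.TraceSeparating.mem_center_iff] at hZ
    have hZA : Z * A = A * Z := hZ.2 A (h𝔡le (h𝔞 hA))
    rw [add_mul, mul_add, hZA, add_sub_add_comm, sub_self, zero_add]
    exact hideal D hD A hA
  have hcent := le_inf_endAlg_of_abelian_ideal H ψ (h𝔞.trans h𝔡le) hideal' hab
  rw [eq_bot_iff]
  intro A hA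
  have h := Submodule.mem_inf.2 ⟨hcent hA, h𝔞 hA⟩
  rwa [hodgeLie_center_inf_derived_eq_bot H ψ] at h

/-- **`[Lie Hg, Lie Hg]` has trivial radical**, any weight (`LieAlgebra.HasTrivialRadical ℚ 𝔏` for every Lie subalgebra
`𝔏 ≤ 𝔤𝔩(V)` with carrier `𝔡`; commutator bracket supplied by `letI`). [cite: Deligne1982HodgeCycles, I §3 Prop. 3.6]
[cite: Humphreys1972, §19.1] -/
theorem hasTrivialRadical_of_eq_hodgeLie_derived (H : HodgeStructure V n) (ψ : H.Polarization) :
    letI : LieRing (Module.End ℚ V) := LieRing.ofAssociativeRing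
    ∀ (𝔏 : LieSubalgebra ℚ (Module.End ℚ V)),
      𝔏.toSubmodule = Submodule.span ℚ {B | ∃ X ∈ H.hodgeLie, ∃ Y ∈ H.hodgeLie, X * Y - Y * X = B} →
      LieAlgebra.HasTrivialRadical ℚ 𝔏 := by
  letI : LieRing (Module.End ℚ V) := LieRing.ofAssociativeRing
  intro 𝔏 h𝔏
  rw [LieAlgebra.hasTrivialRadical_iff_no_abelian_ideals]
  intro I hI
  let 𝔞 : Submodule ℚ (Module.End ℚ V) := I.toSubmodule.map 𝔏.toSubmodule.subtype
  have h𝔞mem : ∀ A, A ∈ 𝔞 ↔ ∃ A' : 𝔏, A' ∈ I ∧ (A' : Module.End ℚ V) = A := fun A => by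
    constructor
    · rintro ⟨A', hA', rfl⟩; exact ⟨A', hA', rfl⟩
    · rintro ⟨A', hA', rfl⟩; exact ⟨A', hA', rfl⟩
  have h𝔞le : 𝔞 ≤ Submodule.span ℚ {B | ∃ X ∈ H.hodgeLie, ∃ Y ∈ H.hodgeLie, X * Y - Y * X = B} := by
    intro A hA
    obtain ⟨A', -, rfl⟩ := (h𝔞mem A).1 hA
    rw [← h𝔏]; exact A'.2
  have hideal : ∀ D ∈ Submodule.span ℚ {B | ∃ X ∈ H.hodgeLie, ∃ Y ∈ H.hodgeLie, X * Y - Y * X = B},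
      ∀ A ∈ 𝔞, D * A - A * D ∈ 𝔞 := by
    intro D hD A hA
    obtain ⟨A', hA', rfl⟩ := (h𝔞mem A).1 hA
    have hD𝔏 : D ∈ 𝔏 := by rw [← LieSubalgebra.mem_toSubmodule, h𝔏]; exact hD
    refine (h𝔞mem _).2 ⟨⁅(⟨D, hD𝔏⟩ : 𝔏), A'⁆, I.lie_mem hA', ?_⟩
    rw [LieSubalgebra.coe_bracket, LieRing.of_associative_ring_bracket]
  have hab : ∀ A ∈ 𝔞, ∀ B ∈ 𝔞, A * B = B * A := by
    intro A hA B hB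
    obtain ⟨A', hA', rfl⟩ := (h𝔞mem A).1 hA
    obtain ⟨B', hB', rfl⟩ := (h𝔞mem B).1 hB
    have h0 : ⁅(⟨A', hA'⟩ : I), (⟨B', hB'⟩ : I)⁆ = 0 := hI.trivial _ _
    have h1 := congrArg (fun Z : I => ((Z : 𝔏) : Module.End ℚ V)) h0
    simp only [LieIdeal.coe_bracket_of_module, LieSubmodule.coe_bracket, ZeroMemClass.coe_zero,
      LieSubalgebra.coe_bracket, LieRing.of_associative_ring_bracket] at h1
    exact sub_eq_zero.1 h1
  have h𝔞0 := hodgeLie_derived_abelian_ideal_eq_bot H ψ h𝔞le hideal hab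
  rw [eq_bot_iff]
  intro A' hA'
  have : (A' : Module.End ℚ V) ∈ 𝔞 := (h𝔞mem _).2 ⟨A', hA', rfl⟩
  rw [h𝔞0, Submodule.mem_bot] at this
  rw [LieSubmodule.mem_bot]
  exact Subtype.ext this

/-- **`[Lie Hg, Lie Hg]` is semisimple** (`LieAlgebra.IsSemisimple ℚ`), any weight. [cite: Deligne1982HodgeCycles, I §3 Prop. 3.6]
[cite: Zarhin1983HodgeGroupsK3, §2] [cite: Humphreys1972, §19.1] -/
theorem isSemisimple_of_eq_hodgeLie_derived (H : HodgeStructure V n) (ψ : H.Polarization) :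
    letI : LieRing (Module.End ℚ V) := LieRing.ofAssociativeRing
    ∀ (𝔏 : LieSubalgebra ℚ (Module.End ℚ V)),
      𝔏.toSubmodule = Submodule.span ℚ {B | ∃ X ∈ H.hodgeLie, ∃ Y ∈ H.hodgeLie, X * Y - Y * X = B} →
      LieAlgebra.IsSemisimple ℚ 𝔏 := by
  letI : LieRing (Module.End ℚ V) := LieRing.ofAssociativeRing
  intro 𝔏 h𝔏
  haveI := hasTrivialRadical_of_eq_hodgeLie_derived H ψ 𝔏 h𝔏
  haveI : Module.Finite ℚ 𝔏 := Module.Finite.of_injective 𝔏.toSubmodule.subtype Subtype.val_injective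
  haveI : LieAlgebra.IsKilling ℚ 𝔏 := LieAlgebra.HasTrivialRadical.instIsKilling ℚ 𝔏
  exact LieAlgebra.IsKilling.instSemisimple ℚ 𝔏

/-- **The Killing form of `[Lie Hg, Lie Hg]` is non-degenerate**, any weight. [cite: Humphreys1972, §5.1]
[cite: Deligne1982HodgeCycles, I §3 Prop. 3.6] -/
theorem isKilling_of_eq_hodgeLie_derived (H : HodgeStructure V n) (ψ : H.Polarization) :
    letI : LieRing (Module.End ℚ V) := LieRing.ofAssociativeRing
    ∀ (𝔏 : LieSubalgebra ℚ (Module.End ℚ V)),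
      𝔏.toSubmodule = Submodule.span ℚ {B | ∃ X ∈ H.hodgeLie, ∃ Y ∈ H.hodgeLie, X * Y - Y * X = B} →
      LieAlgebra.IsKilling ℚ 𝔏 := by
  letI : LieRing (Module.End ℚ V) := LieRing.ofAssociativeRing
  intro 𝔏 h𝔏
  haveI := hasTrivialRadical_of_eq_hodgeLie_derived H ψ 𝔏 h𝔏
  haveI : Module.Finite ℚ 𝔏 := Module.Finite.of_injective 𝔏.toSubmodule.subtype Subtype.val_injective
  exact LieAlgebra.HasTrivialRadical.instIsKilling ℚ 𝔏

end AnyWeight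

end HodgeStructure

end Literature.AlgebraicGeometry.Motives

end
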